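import Summits.ResolutionOfSingularities.ResolutionOfSingularities.Theorems.FrobeniusClosingSteerNoSatelliteStep
import Summits.ResolutionOfSingularities.ResolutionOfSingularities.Theorems.FrobeniusClosingSteerFreeChainBound
import HarnessLib

/-!
# Crux `Steer` (stmt-ResolutionOfSingularities-16345), chain W4.1: **G-perf(3), RATIONAL CASE — no eternal tangential chain with perfect residue fields and
# rational centres in dimension `3`** (Lemma S ∘ Lemma F♭)

OURS (campaign `res-hironaka`, rung L ★L-G4, slot W4.1; seat res-L0-w41-stub-2 g6; res-L0-w41-plan-1 RULING 181c «G-perf(3) rational case = Lemma S ∘ F♭ PART 3»;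
replaces the role of no printed item; NOT a statement of the manuscript under review [claim: Hironaka2017, status: under-review]; AI-produced). Theses-free,
definition-free. The two kernels composed: `NoSatelliteStep.span_excParam_eq_of_rational` (Lemma S: with rational centres at two consecutive stages the second
step is FREE) and `FreeChainBound.not_eternal_free_rational_chain` (Lemma F♭: no eternal all-free rational chain with isolated stage `0`).

* `RationalPerfect.not_eternal_rational_chain_perfect` — in characteristic `2`, dimension `3`, law exponent `2e ≥ 4`: an ℕ-chain of quadratic transforms of
  excellent regular local rings with PERFECT residue fields, RATIONAL centres, radicands with the law `f_{m+1} x_m^(2e) = f_m − g_m²` and ISOLATED torsor germs at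
  every stage does not exist.
The non-rational windows (finite residue extensions) are the K3 binder of `NoSatelliteStep.noTangentialStepPerfect_of_rational`; general residue fields of finite
`2`-rank: `FreeChainBoundPBasis.not_eternal_free_rational_chain` (free part) and res-L0-w41-stub-3's I″ (satellite part). [folklore]
-/

noncomputable section

set_option linter.dupNamespace false

open IsLocalRing
open Literature.AlgebraicGeometry.Resolution
open Summit.ResolutionOfSingularities.ResolutionOfSingularities.Theorems.SwitchingDichotomy
open Summit.ResolutionOfSingularities.ResolutionOfSingularities.Theorems.SwitchingDichotomy.SigmaTopLegality
open Summit.ResolutionOfSingularities.ResolutionOfSingularities.Theorems.SwitchingDichotomy.NoTangentialStep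

namespace Summit.ResolutionOfSingularities.ResolutionOfSingularities.Theorems.SwitchingDichotomy.RationalPerfect

variable {L : Type} [Field L] [CharP L 2]

/-- **Every step of a rational chain is free** (Lemma S read along an ℕ-chain): with rational centres at all stages, perfect residue fields, `S (m+1)` excellent
and the torsor germ at `S (m+1)` isolated, `(x m) = (x (m+1))` in `S (m+2)` for every `m`. [folklore] -/
theorem free_of_rational_chain (e : ℕ) (he : 2 ≤ e) (S : ℕ → Subring L) [∀ m, IsLocalRing (S m)]
    (hle : ∀ m, S m ≤ S (m + 1)) (f g : ∀ m, S m) (x : ∀ m, S (m + 1))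
    (hreg : ∀ m, IsRegularLocalRing (S m)) (hexc : ∀ m, IsExcellentRing (S m)) (hdim : ∀ m, ringKrullDim (S m) = (3 : ℕ))
    (hqt : ∀ m, IsQuadraticTransform (S m) (S (m + 1)))
    (hspan : ∀ m, (maximalIdeal (S m)).map (Subring.inclusion (hle m)) = Ideal.span {x m})
    (hlaw : ∀ m, ((f (m + 1) : S (m + 1)) : L) * ((x m : S (m + 1)) : L) ^ (2 * e) = ((f m : S m) : L) - ((g m : S m) : L) ^ 2)
    (hperf : ∀ m, PerfectField (ResidueField (S m))) (hiso : ∀ m, HasIsolatedSingularity (RadicandRing (S m) 2 (f m)))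
    (hrat : ∀ m (z : S (m + 1)), ∃ s : S m, z - Subring.inclusion (hle m) s ∈ maximalIdeal (S (m + 1))) (m : ℕ) :
    Ideal.span {Subring.inclusion (hle (m + 1)) (x m)} = Ideal.span {x (m + 1)} :=
  NoSatelliteStep.span_excParam_eq_of_rational 3 e (by omega) he (hle m) (hle (m + 1)) (hle (m + 2))
    (hreg m) (hreg (m + 1)) (hreg (m + 2)) (hdim m) (hdim (m + 1)) (hdim (m + 2)) (hqt m) (hqt (m + 1)) (hqt (m + 2))
    (f m) (g m) (f (m + 1)) (g (m + 1)) (f (m + 2)) (g (m + 2)) (f (m + 3)) (x m) (x (m + 1)) (x (m + 2))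
    (hspan m) (hspan (m + 1)) (hspan (m + 2)) (hlaw m) (hlaw (m + 1)) (hlaw (m + 2)) (hperf m) (hexc (m + 1)) (hiso (m + 1))
    (hrat m) (hrat (m + 1))

/-- **G-perf(3), RATIONAL CASE: NO ETERNAL TANGENTIAL CHAIN.** In characteristic `2` and dimension `3` there is no ℕ-chain of quadratic transforms of excellent
regular local subrings of `L` with PERFECT residue fields and RATIONAL centres carrying `2`-radicands with the law of exponent `2e ≥ 4` whose torsor germs
`S_m[T]/(T² − f_m)` are all ISOLATED: by Lemma S every step is free, and Lemma F♭ forbids an eternal all-free rational chain with isolated stage `0`. [folklore] -/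
theorem not_eternal_rational_chain_perfect (e : ℕ) (he : 2 ≤ e) (S : ℕ → Subring L) [∀ m, IsLocalRing (S m)]
    (hle : ∀ m, S m ≤ S (m + 1)) (f g : ∀ m, S m) (x : ∀ m, S (m + 1))
    (hreg : ∀ m, IsRegularLocalRing (S m)) (hexc : ∀ m, IsExcellentRing (S m)) (hdim : ∀ m, ringKrullDim (S m) = (3 : ℕ))
    (hqt : ∀ m, IsQuadraticTransform (S m) (S (m + 1)))
    (hspan : ∀ m, (maximalIdeal (S m)).map (Subring.inclusion (hle m)) = Ideal.span {x m})
    (hlaw : ∀ m, ((f (m + 1) : S (m + 1)) : L) * ((x m : S (m + 1)) : L) ^ (2 * e) = ((f m : S m) : L) - ((g m : S m) : L) ^ 2)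
    (hperf : ∀ m, PerfectField (ResidueField (S m))) (hiso : ∀ m, HasIsolatedSingularity (RadicandRing (S m) 2 (f m)))
    (hrat : ∀ m (z : S (m + 1)), ∃ s : S m, z - Subring.inclusion (hle m) s ∈ maximalIdeal (S (m + 1))) : False :=
  FreeChainBound.not_eternal_free_rational_chain e (by omega) S hle f g x hreg (hexc 0) hdim hqt hspan hlaw hperf
    (fun P _ hP => hiso 0 P hP) (free_of_rational_chain e he S hle f g x hreg hexc hdim hqt hspan hlaw hperf hiso hrat) hrat

end Summit.ResolutionOfSingularities.ResolutionOfSingularities.Theorems.SwitchingDichotomy.RationalPerfect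

end
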